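import Mathlib
import Literature.Computability.MetaComplexity.ACRearrangement
import HarnessLib

/-!
# Exact censuses of the AC-rearrangement universe on three leaves

Small decided instances of the universe cost `ACRewriting.acUniverse` of
`ACRearrangement.lean` (Krajíček's measure `ℓ` / provability within a finite set, for the pure
associative–commutative calculus), kernel-checked:

* `acUniverse_one_three : acUniverse (1 : Equiv.Perm (Fin 3)) = 5` — the identity costs exactly
  the subterm floor `2N - 1`;
* `acUniverse_finRotate_three : acUniverse (finRotate 3) = 8` — the 3-cycle
  `x₀ + (x₁ + x₂) ↦ x₁ + (x₂ + x₀)` costs `8`, ONE MORE than the `7` subterms forced by the two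
  ends: the 7-element floor admits no commutativity or associativity instance at all, so an
  extra node must be paid for (the universe lower-bound phenomenon in its smallest instance).

Method (reusable for larger censuses): `Derives.eq_of_no_instances` — a universe admitting no
comm/assoc instance derives only equalities; `card_lt_of_closes_of_no_instances` — hence a
closing universe is strictly larger than an instance-free subterm floor; the instance-freeness of
an explicit finite universe is a DECIDABLE check (`no_comm_of_check`, `no_assoc_of_check` via the
computable `swapTop` / `rotTop`), discharged by `decide`.

These are the first rungs (decided instances) under the hub route `FregeLinesACUniverse`
(sub-problem `PneNP`), crux `ACRearrangementLowerBound` (`U_AC(π) = Ω(N log N)` for some `π`);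
nothing asymptotic is claimed here.

## Sources

* J. Krajíček, *Bounded Arithmetic, Propositional Logic, and Complexity Theory* (1995),
  Def. 4.4.3 (the measure ℓ), Def. 13.3.1 (provability within a set) — the measure specialised in
  `ACRearrangement.lean`; the computations below are elementary and carry the `folklore` tag.

## Design choices

* Universes are written as `List.toFinset` of explicit term lists so that bounded quantifiers are
  kernel-decidable; `x3 i` abbreviates the leaf `FreeAddMagma.of (i : Fin 3)`.
* No `native_decide` (axiom whitelist); every check is `decide` on terms of size ≤ 5.
-/

namespace Literature.Computability.MetaComplexity

namespace ACRewriting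

open FreeAddMagma

universe v

variable {β : Type v}

section NoInstances

variable [DecidableEq β]

omit [DecidableEq β] in
/-- A derivation within a universe admitting NO commutativity and NO associativity instance is
trivial: it derives only `s = s` (structural induction). [folklore] -/
theorem Derives.eq_of_no_instances {Δ : Finset (FreeAddMagma β)} {s t : FreeAddMagma β}
    (hc : ∀ a b : FreeAddMagma β, a + b ∈ Δ → b + a ∈ Δ → a + b = b + a)
    (ha : ∀ a b c : FreeAddMagma β, a + b + c ∈ Δ → a + (b + c) ∈ Δ → a + b + c = a + (b + c))
    (h : Derives Δ s t) : s = t := by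
  induction h with
  | refl _ => rfl
  | symm _ ih => exact ih.symm
  | trans _ _ ih₁ ih₂ => exact ih₁.trans ih₂
  | comm h₁ h₂ => exact hc _ _ h₁ h₂
  | assoc h₁ h₂ => exact ha _ _ _ h₁ h₂
  | cong _ _ _ _ ih₁ ih₂ => rw [ih₁, ih₂]

/-- The commuted form of a compound term (`none` on a leaf): `swapTop (x + y) = some (y + x)`.
A computable helper turning "Δ admits no commutativity instance" into a decidable check. [folklore] -/
def swapTop : FreeAddMagma β → Option (FreeAddMagma β)
  | FreeAddMagma.of _ => none
  | x + y => some (y + x)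

/-- The re-associated form of a left-nested term (`none` otherwise):
`rotTop ((x + y) + z) = some (x + (y + z))`. [folklore] -/
def rotTop : FreeAddMagma β → Option (FreeAddMagma β)
  | FreeAddMagma.of _ => none
  | FreeAddMagma.of _ + _ => none
  | x + y + z => some (x + (y + z))

/-- If the decidable check "no element of the list `l` has its commuted form in `l` unless equal"
passes, the universe `l.toFinset` admits no proper commutativity instance. [folklore] -/
theorem no_comm_of_check {l : List (FreeAddMagma β)}
    (H : ∀ u ∈ l, ∀ w ∈ l, swapTop u = some w → u = w) (a b : FreeAddMagma β)
    (h₁ : a + b ∈ l.toFinset) (h₂ : b + a ∈ l.toFinset) : a + b = b + a :=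
  H _ (List.mem_toFinset.mp h₁) _ (List.mem_toFinset.mp h₂) rfl

/-- If the decidable check "no element of `l` has its re-associated form in `l` unless equal"
passes, the universe `l.toFinset` admits no proper associativity instance. [folklore] -/
theorem no_assoc_of_check {l : List (FreeAddMagma β)}
    (H : ∀ u ∈ l, ∀ w ∈ l, rotTop u = some w → u = w) (a b c : FreeAddMagma β)
    (h₁ : a + b + c ∈ l.toFinset) (h₂ : a + (b + c) ∈ l.toFinset) : a + b + c = a + (b + c) :=
  H _ (List.mem_toFinset.mp h₁) _ (List.mem_toFinset.mp h₂) rfl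

/-- Lower-bound principle for exact censuses: if the union `Δ₀` of the subterms of `s` and `t`
admits no commutativity/associativity instance and `s ≠ t`, then every closing universe has MORE
than `Δ₀.card` elements. [folklore] -/
theorem card_lt_of_closes_of_no_instances {Δ : Finset (FreeAddMagma β)} {s t : FreeAddMagma β}
    (hst : s ≠ t)
    (hc : ∀ a b : FreeAddMagma β, a + b ∈ subterms s ∪ subterms t → b + a ∈ subterms s ∪ subterms t →
      a + b = b + a)
    (ha : ∀ a b c : FreeAddMagma β, a + b + c ∈ subterms s ∪ subterms t →
      a + (b + c) ∈ subterms s ∪ subterms t → a + b + c = a + (b + c))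
    (h : Closes Δ s t) : (subterms s ∪ subterms t).card < Δ.card := by
  by_contra hle
  rw [not_lt] at hle
  have hsub : subterms s ∪ subterms t ⊆ Δ :=
    Finset.union_subset (h.1 _ h.2.mem.1) (h.1 _ h.2.mem.2)
  have heq : subterms s ∪ subterms t = Δ := Finset.eq_of_subset_of_card_le hsub hle
  subst heq
  exact hst (h.2.eq_of_no_instances hc ha)

end NoInstances

section CensusThree

/-- The leaves `x₀, x₁, x₂` of the three-leaf instance. [folklore] -/
abbrev x3 (i : Fin 3) : FreeAddMagma (Fin 3) := FreeAddMagma.of i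

/-- The generic comb on three leaves is `x₀ + (x₁ + x₂)`. [folklore] -/
theorem combPerm_one_three : combPerm (1 : Equiv.Perm (Fin 3)) = x3 0 + (x3 1 + x3 2) := by
  decide

/-- The comb of the 3-cycle `finRotate 3` is `x₁ + (x₂ + x₀)`. [folklore] -/
theorem combPerm_finRotate_three : combPerm (finRotate 3) = x3 1 + (x3 2 + x3 0) := by
  decide

/-- An explicit 8-element universe closing the 3-cycle rearrangement:
`x₀ + (x₁ + x₂) ~ (x₁ + x₂) + x₀ ~ x₁ + (x₂ + x₀)` (one commutativity, one associativity). [folklore] -/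
theorem closes_finRotate_three :
    Closes ([x3 0, x3 1, x3 2, x3 1 + x3 2, x3 0 + (x3 1 + x3 2), x3 1 + x3 2 + x3 0, x3 2 + x3 0,
      x3 1 + (x3 2 + x3 0)].toFinset) (combPerm (1 : Equiv.Perm (Fin 3))) (combPerm (finRotate 3)) := by
  rw [combPerm_one_three, combPerm_finRotate_three]
  refine ⟨?_, ?_⟩
  · intro u hu
    simp only [List.toFinset_cons, List.toFinset_nil, Finset.mem_insert,
      Finset.notMem_empty, or_false] at hu
    rcases hu with rfl | rfl | rfl | rfl | rfl | rfl | rfl | rfl <;> decide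
  · refine Derives.trans (Derives.comm ?_ ?_) (Derives.assoc ?_ ?_) <;> decide

/-- Upper bound: `U_AC(finRotate 3) ≤ 8`. [folklore] -/
theorem acUniverse_finRotate_three_le : acUniverse (finRotate 3) ≤ 8 :=
  (acUniverse_le_card closes_finRotate_three).trans (by decide)

/-- Lower bound: every universe closing the 3-cycle rearrangement has more than the `7` forced
subterms — the 7-element subterm floor admits no commutativity or associativity instance. [folklore] -/
theorem lt_acUniverse_finRotate_three : 7 < acUniverse (finRotate 3) := by
  obtain ⟨Δ, hcard, hΔ⟩ := exists_card_eq_acUniverse (finRotate 3)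
  rw [← hcard]
  rw [combPerm_one_three, combPerm_finRotate_three] at hΔ
  have e : subterms (x3 0 + (x3 1 + x3 2)) ∪ subterms (x3 1 + (x3 2 + x3 0)) =
      [x3 0, x3 1, x3 2, x3 1 + x3 2, x3 0 + (x3 1 + x3 2), x3 2 + x3 0,
        x3 1 + (x3 2 + x3 0)].toFinset := by decide
  have hcard7 : (subterms (x3 0 + (x3 1 + x3 2)) ∪ subterms (x3 1 + (x3 2 + x3 0))).card = 7 := by
    rw [e]; decide
  rw [← hcard7]
  refine card_lt_of_closes_of_no_instances (by decide) ?_ ?_ hΔ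
  · rw [e]; exact no_comm_of_check (by decide)
  · rw [e]; exact no_assoc_of_check (by decide)

/-- EXACT CENSUS, three leaves: the AC-rearrangement universe of the 3-cycle is `8` — one more than
the subterm floor `7`: sharing constraints force an extra node already at `N = 3`. [folklore] -/
theorem acUniverse_finRotate_three : acUniverse (finRotate 3) = 8 :=
  le_antisymm acUniverse_finRotate_three_le lt_acUniverse_finRotate_three

/-- EXACT CENSUS, three leaves, identity: `U_AC(id) = 5 = 2N - 1`, the subterm floor (the universe
is the set of subterms of the generic comb; nothing is shared or added). [folklore] -/
theorem acUniverse_one_three : acUniverse (1 : Equiv.Perm (Fin 3)) = 5 := by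
  apply le_antisymm
  · have h : Closes (subterms (x3 0 + (x3 1 + x3 2))) (combPerm (1 : Equiv.Perm (Fin 3)))
        (combPerm (1 : Equiv.Perm (Fin 3))) := by
      rw [combPerm_one_three]
      exact ⟨subtermClosed_subterms _, .refl (self_mem_subterms _)⟩
    exact (acUniverse_le_card h).trans (by decide)
  · obtain ⟨Δ, hcard, hΔ⟩ := exists_card_eq_acUniverse (1 : Equiv.Perm (Fin 3))
    rw [← hcard]
    rw [combPerm_one_three] at hΔ
    have hsub : subterms (x3 0 + (x3 1 + x3 2)) ⊆ Δ := hΔ.1 _ hΔ.2.mem.1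
    have h5 : (subterms (x3 0 + (x3 1 + x3 2))).card = 5 := by decide
    exact h5 ▸ Finset.card_le_card hsub

end CensusThree

end ACRewriting

end Literature.Computability.MetaComplexity
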